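import Summits.Schanuel.Schanuel.Theorems.RootDecomp1KNW96Gap
import Mathlib.Analysis.Complex.ExponentialBounds

/-!
# RootDecomp1KNW96Gap02 — lens 6, generation 22 ADDENDUM «NW96-THM1 GAP — second kernel» (critic NOTE L2130: owed CHECKLIST G22 bookkeeping delivered; AUDIT ×1 of record stands, no new count): §A checklist shapes with `D : ℕ` and labels in `ℤ × ℤ` (`box_lt_L_nat`, `nw1996_lemma6_asPrinted_false_int`), §B the width count of step c) — printed (non-negative s) versus proved (signed s) range (`printed_bound_of_nonneg`, `signed_width_exceeds_printed`), §C the SCOPE of the gap typed (`NW1996MainNonreal`, `NW1996MainRH` — Literature target texts) with the PROVED transfer `NW1996MainRH 2 c → NW1996MainR ((127/60)·c)` — part 1 (RootDecomp1KNW96Gap02): §A checklist shapes + §B width count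

(lens-6 g22 HOME addendum NW96Gap2.lean 388f7889…, 448 l, imports the TREE port RootDecomp1KNW96Gap + Mathlib ExponentialBounds, same namespace; ADDENDUM L2119 / RESULT L2120, writer re-check L2126, critic NOTE L2130 (BOOKED, PORT GO LOW as RootDecomp1KNW96Gap02 `--supports stmt-Schanuel-33364`; the two typed-target defs to be placed in Literature like `NW1996MainR`); port by census-1 gen 18 as `RootDecomp1KNW96Gap02`–`03`: 02 = §A + §B, 03 = §C. PORT EDITS: `set_option linter.dupNamespace false` dropped; three one-line docstrings added; `def NW1996MainNonreal` / `def NW1996MainRH` MOVED to Literature/NumberTheory/Transcendental/ExpLogSimultaneousApproximationMeasure.lean (census ONE-file append p829657, next to `NW1996MainR`) and referenced through `open Literature.NumberTheory.Transcendental`; statements and proofs otherwise verbatim. No census credit carried; rung 0; nothing here asserts any constant for NW96 Thm 1.)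
-/

/-!
# NW96 Theorem 1 — audit ADDENDUM (lens 6, generation 22, second kernel)

Companion to the tree file `Summits/Schanuel/Schanuel/Theorems/RootDecomp1KNW96Gap.lean` (the port of this generation's
first kernel; critic VERDICT «NW96-THM1 GAP» CLEARED — AUDIT ×1) answering the critic's CHECKLIST G22 items that the first
kernel left owed, and SHARPENING the diagnosis:

* §A (checklist 2a/2b, verbatim shapes): `box_lt_L_nat` — the box count with `D : ℕ`, `D ≥ 1`, real `U ≥ 1`, `V ≥ 6`,
  `W ≥ 2`; `not_injective_of_intBox` / `det_eq_zero_of_rowLabels'` / `nw1996_lemma6_asPrinted_false_int` — the refutation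
  of the PRINTED Lemma 6 with row labels in `ℤ × ℤ`, rows and columns indexed by ANY finite type of cardinality
  `L = (T+1)(2T₁+1)`, uniformly in the entry function `a : ℤ × ℤ → (n → R)`.
* §B (checklist 2c): the WIDTH COUNT of step c) over abstract naturals `T, T₁, S₁`: `printed_bound_of_nonneg`
  (labels `0 ≤ s ≤ S₁` ⇒ `2·Σ t·s ≤ (T+1)S₁T₁(T₁+1)`, i.e. `≤ ¼LS₁(T₁+½)` by `quarter_bound_of_nonneg`) versus the explicit
  signed matching `sSigned` (labels `±S₁` in the PROVED range `|s| ≤ S₁`): `signed_width_eq` (`= S₁(T+1)T₁(T₁+1)`) and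
  `signed_width_exceeds_printed` (`> ¼LS₁(T₁+½)` once `T₁, S₁ ≥ 1`).
* §C (scope of the gap, typed): NW96 Lemma 5 (Liouville, = Fel'dman 1982 Lemma 9.2) charges `D'·Σ Nᵢ h(αᵢ)` with
  `D' = D/2` when `𝕂 = ℚ(α,β)` is NOT a real field and `D' = D` when it is.  With the signed range the honest `α`-charge per
  row is `D'·(N_Y + N_{Y⁻¹})/L · h(α) ≤ D'·S₁(T₁+½)·h(α)`: for NON-REAL `ℚ(α,β)` this is EXACTLY the printed term
  `½DS₁(T₁+½) log A` of (6.6) and the printed budget closes (211 stands, modulo the misstated Lemma 6); for REAL `ℚ(α,β)`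
  (`D' = D`) it is twice the printed term and the budget fails UNLESS `h(α) ≤ ½ log A`.  Typed: `NW1996MainNonreal c`
  (the registered text restricted to `α ∉ ℝ ∨ β ∉ ℝ`), `NW1996MainRH κ c` (the registered text with `max (κ·h(α)) (1/D) ≤ log A`);
  read-backs `mainRH_one_iff_mainR`, `mainNonreal_of_mainR`; and the PROVED transfer `mainR_of_mainRH_two :
  NW1996MainRH 2 c → NW1996MainR (127/60·c)` (`A ↦ A²`; so what the printed argument proves for all fields,
  `NW1996MainRH 2 211`, already gives every consumer `NW1996MainR 447`).  Nothing in §C is asserted to HOLD: these are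
  typed targets and implications between them.

No `sorry`, no new axioms, no instances, no notation.  HOME-only kernel (decomp-schanuel lens-6 g22 addendum).
-/

namespace Summit.Schanuel.Schanuel.Theorems.RootDecomp1KNW96Gap

open Literature.NumberTheory.Transcendental

/-! ## §A  Checklist shapes: `D : ℕ`, labels in `ℤ × ℤ`, any index type of cardinality `L` -/

/-- The box count with the critic's hypotheses verbatim: `D : ℕ`, `D ≥ 1`, real `U ≥ 1`, `V ≥ 6`, `W ≥ 2` (so `DW ≥ 2`).
`⌊·⌋₊ = Nat.floor`; the paper's `[x]` is the integer part of a positive real, which is `Nat.floor` there. -/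
theorem box_lt_L_nat (D : ℕ) (hD : 1 ≤ D) (U V W : ℝ) (hU : 1 ≤ U) (hV : 6 ≤ V) (hW : 2 ≤ W) :
    ((⌊(21 / 2 : ℝ) * U * V⌋₊ : ℝ) + 1) * ((⌊12 * (D : ℝ) * W + 1 / 2⌋₊ : ℝ) + 1) <
      ((⌊(101 / 5 : ℝ) * (D : ℝ) * V * W⌋₊ : ℝ) + 1) * (2 * (⌊(21 / 5 : ℝ) * U + 1 / 2⌋₊ : ℝ) + 1) := by
  have hD' : (1 : ℝ) ≤ D := by exact_mod_cast hD
  exact box_lt_L (D : ℝ) U V W hU hV (by nlinarith)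

/-- Row labels `(σ_μ, s_μ) ∈ ℤ × ℤ` in the box `0 ≤ σ ≤ S`, `0 ≤ s ≤ S₁` with `(S+1)(S₁+1) < #rows` cannot be pairwise
distinct (rows indexed by any finite type). -/
theorem not_injective_of_intBox {n : Type*} [Fintype n] {S S₁ : ℕ} (ρ : n → ℤ × ℤ)
    (hρ : ∀ μ, 0 ≤ (ρ μ).1 ∧ (ρ μ).1 ≤ S ∧ 0 ≤ (ρ μ).2 ∧ (ρ μ).2 ≤ S₁)
    (hL : (S + 1) * (S₁ + 1) < Fintype.card n) :
    ¬ Function.Injective ρ := by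
  intro hinj
  let g : n → Fin (S + 1) × Fin (S₁ + 1) := fun μ =>
    (⟨((ρ μ).1).toNat, by have := hρ μ; omega⟩, ⟨((ρ μ).2).toNat, by have := hρ μ; omega⟩)
  have hg : Function.Injective g := by
    intro μ μ' h
    apply hinj
    have h1 : ((ρ μ).1).toNat = ((ρ μ').1).toNat := by
      have := congrArg (fun p => (p.1 : ℕ)) h
      simpa [g] using this
    have h2 : ((ρ μ).2).toNat = ((ρ μ').2).toNat := by
      have := congrArg (fun p => (p.2 : ℕ)) h
      simpa [g] using this
    have e1 : (ρ μ).1 = (ρ μ').1 := by have := hρ μ; have := hρ μ'; omega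
    have e2 : (ρ μ).2 = (ρ μ').2 := by have := hρ μ; have := hρ μ'; omega
    exact Prod.ext e1 e2
  have hcard := Fintype.card_le_of_injective g hg
  simp only [Fintype.card_prod, Fintype.card_fin] at hcard
  omega

/-- A square matrix (any finite index type) whose `μ`-th row depends only on a label `ρ μ`, with `ρ` not injective, has
determinant `0` (two equal rows, `Matrix.det_zero_of_row_eq`).  Uniform in the entry function `a`. -/
theorem det_eq_zero_of_rowLabels' {R : Type*} [CommRing R] {n : Type*} [Fintype n] [DecidableEq n]
    {κ : Type*} (ρ : n → κ) (a : κ → n → R) (h : ¬ Function.Injective ρ) :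
    (Matrix.of fun μ ν => a (ρ μ) ν).det = 0 := by
  have : ∃ μ μ', μ ≠ μ' ∧ ρ μ = ρ μ' := by
    by_contra hcon
    push Not at hcon
    exact h (fun μ μ' hμ => by_contra fun hne => hcon μ μ' hne hμ)
  obtain ⟨μ, μ', hne, heq⟩ := this
  exact Matrix.det_zero_of_row_eq hne (by ext ν; simp [heq])

/-- **NW96 Lemma 6 as printed is false — the checklist shape (2b).**  `D ≥ 1` (`D : ℕ`), `U ≥ 1`, `V ≥ 6`, `W ≥ 2`;
`S = [10.5UV]`, `S₁ = [12DW + ½]`, `T = [20.2DVW]`, `T₁ = [4.2U + ½]` (`[·] = Nat.floor`); for ANY commutative ring `R`,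
ANY index type `n` with `#n = L = (T+1)(2T₁+1)`, ANY entry function `a : ℤ × ℤ → (n → R)` and ANY row labels
`μ ↦ (σ_μ, s_μ) ∈ [0,S] × [0,S₁] ⊂ ℤ × ℤ`: `det ‖a (σ_μ,s_μ) ν‖ = 0`. -/
theorem nw1996_lemma6_asPrinted_false_int {R : Type*} [CommRing R] {n : Type*} [Fintype n] [DecidableEq n]
    (D : ℕ) (hD : 1 ≤ D) (U V W : ℝ) (hU : 1 ≤ U) (hV : 6 ≤ V) (hW : 2 ≤ W)
    (S S₁ T T₁ : ℕ) (hS : S = ⌊(21 / 2 : ℝ) * U * V⌋₊) (hS₁ : S₁ = ⌊12 * (D : ℝ) * W + 1 / 2⌋₊)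
    (hT : T = ⌊(101 / 5 : ℝ) * (D : ℝ) * V * W⌋₊) (hT₁ : T₁ = ⌊(21 / 5 : ℝ) * U + 1 / 2⌋₊)
    (hn : Fintype.card n = (T + 1) * (2 * T₁ + 1))
    (a : ℤ × ℤ → n → R) (ρ : n → ℤ × ℤ)
    (hρ : ∀ μ, 0 ≤ (ρ μ).1 ∧ (ρ μ).1 ≤ S ∧ 0 ≤ (ρ μ).2 ∧ (ρ μ).2 ≤ S₁) :
    (Matrix.of fun μ ν => a (ρ μ) ν).det = 0 := by
  apply det_eq_zero_of_rowLabels' ρ a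
  apply not_injective_of_intBox ρ hρ
  have h := box_lt_L_nat D hD U V W hU hV hW
  rw [← hS, ← hS₁, ← hT, ← hT₁, hn] at *
  exact_mod_cast h

/-- Variant under the weaker standing bound `DW ≥ 2` with real `D`. -/
theorem nw1996_lemma6_asPrinted_false_int' {R : Type*} [CommRing R] {n : Type*} [Fintype n] [DecidableEq n]
    (D U V W : ℝ) (hU : 1 ≤ U) (hV : 6 ≤ V) (hDW : 2 ≤ D * W)
    (S S₁ T T₁ : ℕ) (hS : S = ⌊(21 / 2 : ℝ) * U * V⌋₊) (hS₁ : S₁ = ⌊12 * D * W + 1 / 2⌋₊)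
    (hT : T = ⌊(101 / 5 : ℝ) * D * V * W⌋₊) (hT₁ : T₁ = ⌊(21 / 5 : ℝ) * U + 1 / 2⌋₊)
    (hn : Fintype.card n = (T + 1) * (2 * T₁ + 1))
    (a : ℤ × ℤ → n → R) (ρ : n → ℤ × ℤ)
    (hρ : ∀ μ, 0 ≤ (ρ μ).1 ∧ (ρ μ).1 ≤ S ∧ 0 ≤ (ρ μ).2 ∧ (ρ μ).2 ≤ S₁) :
    (Matrix.of fun μ ν => a (ρ μ) ν).det = 0 := by
  apply det_eq_zero_of_rowLabels' ρ a
  apply not_injective_of_intBox ρ hρ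
  have h := box_lt_L D U V W hU hV hDW
  rw [← hS, ← hS₁, ← hT, ← hT₁, hn] at *
  exact_mod_cast h

/-! ## §B  The width count of step c): printed (non-negative `s`) versus proved (signed `s`) range

Columns are `(τ, j) ∈ Fin (T+1) × Fin (2T₁+1)` with frequency `t = j − T₁ ∈ [−T₁, T₁]`; in the Leibniz expansion of
`R = det ‖q_{τt}^{σ_μ s_μ}(X,Y)‖` the monomial of a bijection `π : columns → rows` has `Y`-exponent `Σ_{(τ,t)} t · s_{π(τ,t)}`.
Below `s c` is the `s`-label of the row matched to column `c` (the bijection is absorbed into `s`).  Over abstract naturals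
`T, T₁, S₁` (no floors). -/

/-- `Σ_{j=0}^{2n} |j − n| = n(n+1)`. -/
theorem sum_range_abs_sub (n : ℕ) :
    ∑ i ∈ Finset.range (2 * n + 1), |((i : ℕ) : ℤ) - n| = n * (n + 1) := by
  induction n with
  | zero => simp
  | succ n ih =>
    have e : 2 * (n + 1) + 1 = (2 * n + 1) + 1 + 1 := by ring
    rw [e, Finset.sum_range_succ', Finset.sum_range_succ]
    have h1 : ∀ i ∈ Finset.range (2 * n + 1), |(((i + 1 : ℕ) : ℕ) : ℤ) - (n + 1 : ℕ)| = |((i : ℕ) : ℤ) - n| := by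
      intro i _; push_cast; ring_nf
    rw [Finset.sum_congr rfl h1, ih]
    push_cast
    have h2 : |(2 * (n : ℤ) + 1 + 1) - (n + 1)| = n + 1 := by
      rw [abs_of_nonneg (by omega)]; ring
    have h3 : |(0 : ℤ) - ((n : ℤ) + 1)| = n + 1 := by
      rw [abs_of_nonpos (by omega)]; ring
    rw [h2, h3]; ring

/-- `2 Σ_{j=0}^{2n} max(0, j − n) = n(n+1)`. -/
theorem two_mul_sum_range_max_sub (n : ℕ) :
    2 * ∑ i ∈ Finset.range (2 * n + 1), max 0 (((i : ℕ) : ℤ) - n) = n * (n + 1) := by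
  induction n with
  | zero => simp
  | succ n ih =>
    have e : 2 * (n + 1) + 1 = (2 * n + 1) + 1 + 1 := by ring
    rw [e, Finset.sum_range_succ', Finset.sum_range_succ]
    have h1 : ∀ i ∈ Finset.range (2 * n + 1),
        max 0 ((((i + 1 : ℕ) : ℕ) : ℤ) - (n + 1 : ℕ)) = max 0 (((i : ℕ) : ℤ) - n) := by
      intro i _; push_cast; ring_nf
    rw [Finset.sum_congr rfl h1]
    push_cast
    have h2 : max 0 ((2 * (n : ℤ) + 1 + 1) - (n + 1)) = n + 1 := by
      rw [max_eq_right (by omega)]; ring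
    have h3 : max 0 ((0 : ℤ) - ((n : ℤ) + 1)) = 0 := by
      rw [max_eq_left (by omega)]
    rw [h2, h3]
    linear_combination ih

/-- `Σ_{j : Fin (2n+1)} |j − n| = n(n+1)` and `2 Σ max(0, j − n) = n(n+1)`, over `Fin`. -/
theorem sum_fin_abs_sub (n : ℕ) : ∑ j : Fin (2 * n + 1), |((j : ℕ) : ℤ) - n| = n * (n + 1) := by
  rw [Fin.sum_univ_eq_sum_range (fun i => |((i : ℕ) : ℤ) - n|) (2 * n + 1)]
  exact sum_range_abs_sub n

/-- `2 · Σ_{j < 2T₁+1} max (j − T₁) 0 = T₁ (T₁ + 1)` (the one-sided width sum). -/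
theorem two_mul_sum_fin_max_sub (n : ℕ) :
    2 * ∑ j : Fin (2 * n + 1), max 0 (((j : ℕ) : ℤ) - n) = n * (n + 1) := by
  rw [Fin.sum_univ_eq_sum_range (fun i => max 0 (((i : ℕ) : ℤ) - n)) (2 * n + 1)]
  exact two_mul_sum_range_max_sub n

/-- **The printed bound is the non-negative-range count.**  If every matched row label satisfies `0 ≤ s ≤ S₁` (the PRINTED
range of Lemma 6), then `2 · Σ_{(τ,t)} t·s_{(τ,t)} ≤ (T+1)·S₁·T₁(T₁+1)`, i.e. `deg_Y ≤ (T+1)S₁T₁(T₁+1)/2`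
(`= L S₁ T₁(T₁+1)/(2(2T₁+1)) ≤ ¼ L S₁ (T₁+½)`, `quarter_bound_of_nonneg`). -/
theorem printed_bound_of_nonneg (T T₁ S₁ : ℕ) (s : Fin (T + 1) × Fin (2 * T₁ + 1) → ℤ)
    (hs : ∀ c, 0 ≤ s c ∧ s c ≤ S₁) :
    2 * ∑ c, ((((c.2 : ℕ) : ℤ) - T₁) * s c) ≤ (T + 1) * S₁ * (T₁ * (T₁ + 1)) := by
  have hterm : ∀ c : Fin (T + 1) × Fin (2 * T₁ + 1),
      (((c.2 : ℕ) : ℤ) - T₁) * s c ≤ S₁ * max 0 (((c.2 : ℕ) : ℤ) - T₁) := by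
    intro c
    obtain ⟨h0, h1⟩ := hs c
    rcases le_or_gt 0 (((c.2 : ℕ) : ℤ) - T₁) with ht | ht
    · rw [max_eq_right ht]; nlinarith
    · rw [max_eq_left ht.le]; nlinarith
  have hsum : ∑ c, ((((c.2 : ℕ) : ℤ) - T₁) * s c) ≤
      ∑ c : Fin (T + 1) × Fin (2 * T₁ + 1), S₁ * max 0 (((c.2 : ℕ) : ℤ) - T₁) :=
    Finset.sum_le_sum fun c _ => hterm c
  have hval : 2 * ∑ c : Fin (T + 1) × Fin (2 * T₁ + 1), (S₁ : ℤ) * max 0 (((c.2 : ℕ) : ℤ) - T₁) =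
      (T + 1) * S₁ * (T₁ * (T₁ + 1)) := by
    rw [Fintype.sum_prod_type]
    simp only [Finset.sum_const, Finset.card_univ, Fintype.card_fin]
    rw [← Finset.mul_sum]
    have := two_mul_sum_fin_max_sub T₁
    linear_combination ((T : ℤ) + 1) * S₁ * this
  linarith

/-- … and `(T+1)S₁T₁(T₁+1)/2 ≤ ¼·L·S₁·(T₁+½)` with `L = (T+1)(2T₁+1)` (difference `= (T+1)S₁/8`). -/
theorem quarter_bound_of_nonneg (T T₁ S₁ : ℕ) :
    ((T : ℚ) + 1) * S₁ * (T₁ * (T₁ + 1)) / 2 ≤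
      (1 / 4 : ℚ) * (((T : ℚ) + 1) * (2 * T₁ + 1)) * S₁ * (T₁ + 1 / 2) := by
  have hT : (0 : ℚ) ≤ T := Nat.cast_nonneg _
  have hS₁ : (0 : ℚ) ≤ S₁ := Nat.cast_nonneg _
  nlinarith [mul_nonneg (by linarith : (0:ℚ) ≤ T + 1) hS₁]

/-- The explicit SIGNED matching (labels in the PROVED range `|s| ≤ S₁`): `s = S₁·sign(t)`. -/
def sSigned (T₁ S₁ : ℕ) (j : Fin (2 * T₁ + 1)) : ℤ :=
  if (T₁ : ℤ) < ((j : ℕ) : ℤ) then S₁ else if ((j : ℕ) : ℤ) < T₁ then -(S₁ : ℤ) else 0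

/-- The signed labels satisfy `|s| ≤ S₁`. -/
theorem abs_sSigned_le (T₁ S₁ : ℕ) (j : Fin (2 * T₁ + 1)) : |sSigned T₁ S₁ j| ≤ S₁ := by
  unfold sSigned
  split_ifs <;> simp

/-- The product `t · s` for the extremal signed labelling. -/
theorem t_mul_sSigned (T₁ S₁ : ℕ) (j : Fin (2 * T₁ + 1)) :
    (((j : ℕ) : ℤ) - T₁) * sSigned T₁ S₁ j = S₁ * |((j : ℕ) : ℤ) - T₁| := by
  unfold sSigned
  split_ifs with h1 h2
  · rw [abs_of_pos (by omega)]; ring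
  · rw [abs_of_neg (by omega)]; ring
  · have : ((j : ℕ) : ℤ) = T₁ := by omega
    rw [this]; simp

/-- **The signed range doubles the width.**  With the signed labels `s_{(τ,t)} = S₁·sign t` (all in `[−S₁, S₁]`):
`Σ_{(τ,t)} t·s_{(τ,t)} = S₁·(T+1)·T₁(T₁+1)` — TWICE the non-negative maximum, and (next lemma) strictly above the printed
`¼ L S₁ (T₁+½)` as soon as `T₁, S₁ ≥ 1`.  (Realising this matching with DISTINCT row labels `(σ_μ, s_μ)`, `σ_μ ≤ S`, needs
`S+1 ≥ (T+1)T₁` rows per `s`-level; under the paper's parameters only `S+1` rows share an `s`-value and the attainable width is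
still `≥ 0.72×` this — REPAIR.md §2.) -/
theorem signed_width_eq (T T₁ S₁ : ℕ) :
    ∑ c : Fin (T + 1) × Fin (2 * T₁ + 1), ((((c.2 : ℕ) : ℤ) - T₁) * sSigned T₁ S₁ c.2) =
      S₁ * ((T + 1) * (T₁ * (T₁ + 1))) := by
  simp_rw [t_mul_sSigned]
  rw [Fintype.sum_prod_type]
  simp only [Finset.sum_const, Finset.card_univ, Fintype.card_fin]
  rw [← Finset.mul_sum, sum_fin_abs_sub]
  ring

/-- `¼ L S₁ (T₁+½) < S₁ (T+1) T₁ (T₁+1)` for `T₁ ≥ 1`, `S₁ ≥ 1` (`L = (T+1)(2T₁+1)`): the printed bound FAILS for the signed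
matching. -/
theorem signed_width_exceeds_printed (T T₁ S₁ : ℕ) (hT₁ : 1 ≤ T₁) (hS₁ : 1 ≤ S₁) :
    (1 / 4 : ℚ) * (((T : ℚ) + 1) * (2 * T₁ + 1)) * S₁ * (T₁ + 1 / 2) <
      (S₁ : ℚ) * (((T : ℚ) + 1) * (T₁ * (T₁ + 1))) := by
  have hT : (0 : ℚ) ≤ T := Nat.cast_nonneg _
  have hT₁' : (1 : ℚ) ≤ T₁ := by exact_mod_cast hT₁
  have hS₁' : (1 : ℚ) ≤ S₁ := by exact_mod_cast hS₁
  have hpos : (0 : ℚ) < (T + 1) * S₁ := by nlinarith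
  -- RHS − LHS = (T+1) S₁ (T₁² + T₁ − 1/4)/2 > 0
  nlinarith [mul_pos hpos (by nlinarith : (0 : ℚ) < (T₁ : ℚ) ^ 2 + T₁ - 1 / 4)]

end Summit.Schanuel.Schanuel.Theorems.RootDecomp1KNW96Gap
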